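import Literature.NumberTheory.LFunctions.YoshidaWindowGram
import Literature.NumberTheory.LFunctions.RiemannSiegelFacts
import Literature.Analysis.ValidatedNumerics.DigammaKernelValues
import HarnessLib

/-!
# Kernel enclosures of Yoshida's matrix coefficients — I: special values, parity, tails, prime data

Source: H. Yoshida, *On Hermitian forms attached to zeta functions*, Adv. Stud. Pure Math. **21** (1992)
281–325, §5 (5.15)/(5.16) p. 301 [Yoshida1992HermitianForms] — the coefficients `gramCoeff a n m`
(`YoshidaWindowGram.lean`).  "The sums `Σ_{k=0}^∞` in them converge rapidly. … we can compute `(χ_n, χ_m)`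
with sufficient accuracy" (p. 302): this file and its sequels (`…EntryBox`, `…BlockCheck`) make that
computation a KERNEL one, on the tree's multi-precision interval engine (`NumericsMP.MI`/`MC` at a binary
scale `S`; `MC.digammaBox`, `MC.trigammaBox`, `MI.exp`, `MC.expI`, `MI.logNat2`, `MI.logPos`).

Contents of part I (all proved; no named facts):
* parity of the off-diagonal special values in the mode (`freq_neg`, `im_digamma_quarter_neg`,
  `archExpSumSin_neg`, `cexp_neg_mul_I`) — the sector kernels only ever need `G(n, m)` with `n ≥ 0`, so a table
  over `n = 0 … N` and these sign rules cover `G(n, −m)`;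
* the exponential sums `archExpSumDiag`, `archExpSumSin`: summability and the geometric tail bound
  `|Σ_{k ≥ K} …| ≤ e^{−a(4K+1)}/(1 − e^{−4a})` (`K ≥ 1`);
* `PrimeLen`/`PrimeData`: the prime powers `k = p^e` of the window as a list, and `primeCoeff` as the
  corresponding finite list sum with weights `Λ(k)k^{−1/2} = log p · e^{−e log p/2}` (`primeCoeff_eq_listSum`).
Parts II–V (`YoshidaWindowGramRecords`, `…SpecialValues`, `…EntryBox`, `…BlockCheck`) build the interval records,
the entry box `∋ gramCoeff a n m` and the literal-data checkers on top.
-/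

open Real Complex Finset
open scoped BigOperators

namespace Literature.NumberTheory.LFunctions.Yoshida1992

open Literature.Analysis.SpecialFunctions Literature.Analysis.ValidatedNumerics.NumericsMP
open scoped ArithmeticFunction.vonMangoldt

/-! ## 1. Parity in the mode of the off-diagonal special values -/

/-- `ω_{−n} = −ω_n`. [cite: Yoshida1992HermitianForms, §3 p. 289] -/
theorem freq_neg (a : ℝ) (n : ℤ) : freq a (-n) = -freq a n := by
  unfold freq; push_cast; ring

/-- The point `¼ + i(−ω)/2` is the conjugate of `¼ + iω/2`. [cite: Yoshida1992HermitianForms, §5 pp. 301–302 ((5.15)/(5.16) and "the sums converge rapidly")] -/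
theorem quarter_add_neg_eq_conj (ω : ℝ) :
    (1 / 4 + (((-ω : ℝ)) : ℂ) / 2 * I) = (starRingEnd ℂ) (1 / 4 + (ω : ℂ) / 2 * I) := by
  apply Complex.ext
  · simp [Complex.conj_ofNat]
  · simp [Complex.conj_ofNat]; ring

/-- `Im ψ(¼ − iω/2) = −Im ψ(¼ + iω/2)` (`ψ(s̄) = conj ψ(s)`). [cite: Yoshida1992HermitianForms, §5 pp. 301–302 ((5.15)/(5.16) and "the sums converge rapidly")] -/
theorem im_digamma_quarter_neg (ω : ℝ) :
    (Complex.digamma (1 / 4 + (((-ω : ℝ)) : ℂ) / 2 * I)).im = -(Complex.digamma (1 / 4 + (ω : ℂ) / 2 * I)).im := by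
  rw [quarter_add_neg_eq_conj, digamma_conj, Complex.conj_im]

/-- The off-diagonal exponential sum is odd in the mode. [cite: Yoshida1992HermitianForms, §5 (5.16) p. 301] -/
theorem archExpSumSin_neg (a : ℝ) (n : ℤ) : archExpSumSin a (-n) = -archExpSumSin a n := by
  unfold archExpSumSin
  rw [← tsum_neg]
  refine tsum_congr fun k ↦ ?_
  rw [freq_neg, neg_sq]
  ring

/-- `e^{i(−ω)t} = conj e^{iωt}`. [cite: Yoshida1992HermitianForms, §5 pp. 301–302 ((5.15)/(5.16) and "the sums converge rapidly")] -/
theorem cexp_neg_mul_I (θ : ℝ) :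
    Complex.exp ((((-θ : ℝ)) : ℂ) * I) = (starRingEnd ℂ) (Complex.exp ((θ : ℂ) * I)) := by
  rw [← Complex.exp_conj, map_mul, Complex.conj_ofReal, Complex.conj_I]
  push_cast
  ring_nf

/-! ## 2. The exponential sums: summability and the geometric tail -/

/-- `e^{−2a l_k} = e^{−a}·(e^{−4a})^k`, `l_k = 2k + ½`. [cite: Yoshida1992HermitianForms, §5 pp. 301–302 ((5.15)/(5.16) and "the sums converge rapidly")] -/
theorem exp_node_eq (a : ℝ) (k : ℕ) :
    Real.exp (-(2 * a * digammaNode k)) = Real.exp (-a) * Real.exp (-(4 * a)) ^ k := by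
  rw [← Real.exp_nat_mul, ← Real.exp_add]
  congr 1
  unfold digammaNode
  ring

/-- The diagonal factor is bounded: `|(l² − ω²)/(l² + ω²)²| ≤ 1/l²` (`l > 0`). [cite: Yoshida1992HermitianForms, §5 pp. 301–302 ((5.15)/(5.16) and "the sums converge rapidly")] -/
theorem abs_diagFactor_le {l : ℝ} (hl : 0 < l) (ω : ℝ) :
    |(l ^ 2 - ω ^ 2) / (l ^ 2 + ω ^ 2) ^ 2| ≤ 1 / l ^ 2 := by
  have h1 : 0 < l ^ 2 + ω ^ 2 := by positivity
  rw [abs_div, abs_of_pos (by positivity : (0:ℝ) < (l ^ 2 + ω ^ 2) ^ 2)]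
  have h2 : |l ^ 2 - ω ^ 2| ≤ l ^ 2 + ω ^ 2 := by
    rw [abs_le]; constructor <;> nlinarith [sq_nonneg l, sq_nonneg ω]
  calc |l ^ 2 - ω ^ 2| / (l ^ 2 + ω ^ 2) ^ 2 ≤ (l ^ 2 + ω ^ 2) / (l ^ 2 + ω ^ 2) ^ 2 :=
        div_le_div_of_nonneg_right h2 (by positivity)
    _ = 1 / (l ^ 2 + ω ^ 2) := by field_simp
    _ ≤ 1 / l ^ 2 := by
        apply one_div_le_one_div_of_le (by positivity); nlinarith [sq_nonneg ω]

/-- The sine factor is bounded: `|ω/(l² + ω²)| ≤ 1/(2l)` (`l > 0`). [cite: Yoshida1992HermitianForms, §5 pp. 301–302 ((5.15)/(5.16) and "the sums converge rapidly")] -/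
theorem abs_sinFactor_le {l : ℝ} (hl : 0 < l) (ω : ℝ) :
    |ω / (l ^ 2 + ω ^ 2)| ≤ 1 / (2 * l) := by
  have h1 : 0 < l ^ 2 + ω ^ 2 := by positivity
  rw [abs_div, abs_of_pos h1, div_le_div_iff₀ h1 (by positivity)]
  nlinarith [sq_nonneg (|ω| - l), abs_nonneg ω, sq_abs ω]

/-- `1/l_k² ≤ 4` and, for `k ≥ 1`, `1/l_k² ≤ 1`; `1/(2 l_k) ≤ 1`. [cite: Yoshida1992HermitianForms, §5 pp. 301–302 ((5.15)/(5.16) and "the sums converge rapidly")] -/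
theorem inv_digammaNode_sq_le_four (k : ℕ) : 1 / digammaNode k ^ 2 ≤ 4 := by
  have h := one_half_le_digammaNode k
  rw [div_le_iff₀ (by positivity)]
  nlinarith

/-- [cite: Yoshida1992HermitianForms, §5 pp. 301–302 ((5.15)/(5.16) and "the sums converge rapidly")] -/
theorem inv_digammaNode_sq_le_one {k : ℕ} (hk : 1 ≤ k) : 1 / digammaNode k ^ 2 ≤ 1 := by
  have h : (5 : ℝ) / 2 ≤ digammaNode k := by
    unfold digammaNode
    have : (1 : ℝ) ≤ k := by exact_mod_cast hk
    linarith
  rw [div_le_iff₀ (by positivity)]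
  nlinarith

/-- [cite: Yoshida1992HermitianForms, §5 pp. 301–302 ((5.15)/(5.16) and "the sums converge rapidly")] -/
theorem inv_two_mul_digammaNode_le_one (k : ℕ) : 1 / (2 * digammaNode k) ≤ 1 := by
  have h := one_half_le_digammaNode k
  rw [div_le_iff₀ (by linarith)]
  linarith

/-- The `k`-th term of `archExpSumDiag`. [cite: Yoshida1992HermitianForms, §5 (5.15) p. 301] -/
noncomputable def diagTerm (a : ℝ) (n : ℤ) (k : ℕ) : ℝ :=
  Real.exp (-(2 * a * digammaNode k)) * ((digammaNode k ^ 2 - freq a n ^ 2) / (digammaNode k ^ 2 + freq a n ^ 2) ^ 2)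

/-- The `k`-th term of `archExpSumSin`. [cite: Yoshida1992HermitianForms, §5 (5.16) p. 301] -/
noncomputable def sinTerm (a : ℝ) (n : ℤ) (k : ℕ) : ℝ :=
  Real.exp (-(2 * a * digammaNode k)) * (freq a n / (digammaNode k ^ 2 + freq a n ^ 2))

/-- `|diagTerm| ≤ 4·e^{−a}(e^{−4a})^k`. [cite: Yoshida1992HermitianForms, §5 pp. 301–302 ((5.15)/(5.16) and "the sums converge rapidly")] -/
theorem abs_diagTerm_le (a : ℝ) (n : ℤ) (k : ℕ) :
    |diagTerm a n k| ≤ 4 * (Real.exp (-a) * Real.exp (-(4 * a)) ^ k) := by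
  unfold diagTerm
  rw [abs_mul, abs_of_pos (Real.exp_pos _), exp_node_eq]
  have h := (abs_diagFactor_le (digammaNode_pos k) (freq a n)).trans (inv_digammaNode_sq_le_four k)
  have h0 : 0 ≤ Real.exp (-a) * Real.exp (-(4 * a)) ^ k := by positivity
  nlinarith

/-- `|sinTerm| ≤ e^{−a}(e^{−4a})^k`. [cite: Yoshida1992HermitianForms, §5 pp. 301–302 ((5.15)/(5.16) and "the sums converge rapidly")] -/
theorem abs_sinTerm_le (a : ℝ) (n : ℤ) (k : ℕ) :
    |sinTerm a n k| ≤ Real.exp (-a) * Real.exp (-(4 * a)) ^ k := by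
  unfold sinTerm
  rw [abs_mul, abs_of_pos (Real.exp_pos _), exp_node_eq]
  refine mul_le_of_le_one_right (by positivity) ?_
  exact (abs_sinFactor_le (digammaNode_pos k) _).trans (inv_two_mul_digammaNode_le_one k)

/-- For `k ≥ 1`: `|diagTerm| ≤ e^{−a}(e^{−4a})^k`. [cite: Yoshida1992HermitianForms, §5 pp. 301–302 ((5.15)/(5.16) and "the sums converge rapidly")] -/
theorem abs_diagTerm_le_of_one_le (a : ℝ) (n : ℤ) {k : ℕ} (hk : 1 ≤ k) :
    |diagTerm a n k| ≤ Real.exp (-a) * Real.exp (-(4 * a)) ^ k := by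
  unfold diagTerm
  rw [abs_mul, abs_of_pos (Real.exp_pos _), exp_node_eq]
  refine mul_le_of_le_one_right (by positivity) ?_
  exact (abs_diagFactor_le (digammaNode_pos k) _).trans (inv_digammaNode_sq_le_one hk)

variable {a : ℝ}

/-- `0 ≤ e^{−4a} < 1` for `a > 0`. [cite: Yoshida1992HermitianForms, §5 pp. 301–302 ((5.15)/(5.16) and "the sums converge rapidly")] -/
theorem exp_neg_four_mul_lt_one (ha : 0 < a) : Real.exp (-(4 * a)) < 1 := by
  rw [Real.exp_lt_one_iff]; linarith

/-- The geometric majorant is summable. [cite: Yoshida1992HermitianForms, §5 pp. 301–302 ((5.15)/(5.16) and "the sums converge rapidly")] -/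
theorem summable_exp_geom (ha : 0 < a) :
    Summable fun k : ℕ ↦ Real.exp (-a) * Real.exp (-(4 * a)) ^ k :=
  (summable_geometric_of_lt_one (Real.exp_pos _).le (exp_neg_four_mul_lt_one ha)).mul_left _

/-- `diagTerm` is summable. [cite: Yoshida1992HermitianForms, §5 pp. 301–302 ((5.15)/(5.16) and "the sums converge rapidly")] -/
theorem summable_diagTerm (ha : 0 < a) (n : ℤ) : Summable (diagTerm a n) :=
  Summable.of_norm_bounded ((summable_exp_geom ha).mul_left 4) fun k ↦ by
    rw [Real.norm_eq_abs]; exact abs_diagTerm_le a n k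

/-- `sinTerm` is summable. [cite: Yoshida1992HermitianForms, §5 pp. 301–302 ((5.15)/(5.16) and "the sums converge rapidly")] -/
theorem summable_sinTerm (ha : 0 < a) (n : ℤ) : Summable (sinTerm a n) :=
  Summable.of_norm_bounded (summable_exp_geom ha) fun k ↦ by
    rw [Real.norm_eq_abs]; exact abs_sinTerm_le a n k

/-- `archExpSumDiag = Σ' diagTerm`. [cite: Yoshida1992HermitianForms, §5 (5.15) p. 301] -/
theorem archExpSumDiag_eq_tsum (a : ℝ) (n : ℤ) : archExpSumDiag a n = ∑' k, diagTerm a n k := rfl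

/-- `archExpSumSin = Σ' sinTerm`. [cite: Yoshida1992HermitianForms, §5 (5.16) p. 301] -/
theorem archExpSumSin_eq_tsum (a : ℝ) (n : ℤ) : archExpSumSin a n = ∑' k, sinTerm a n k := rfl

/-- The geometric tail: `Σ_{k} e^{−a}(e^{−4a})^{k+K} = e^{−a}(e^{−4a})^K/(1 − e^{−4a})`. [cite: Yoshida1992HermitianForms, §5 pp. 301–302 ((5.15)/(5.16) and "the sums converge rapidly")] -/
theorem tsum_exp_geom_shift (ha : 0 < a) (K : ℕ) :
    ∑' k : ℕ, Real.exp (-a) * Real.exp (-(4 * a)) ^ (k + K)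
      = Real.exp (-a) * Real.exp (-(4 * a)) ^ K / (1 - Real.exp (-(4 * a))) := by
  have hq := exp_neg_four_mul_lt_one ha
  have e : ∀ k : ℕ, Real.exp (-a) * Real.exp (-(4 * a)) ^ (k + K)
      = (Real.exp (-a) * Real.exp (-(4 * a)) ^ K) * Real.exp (-(4 * a)) ^ k := fun k ↦ by
    rw [pow_add]; ring
  simp_rw [e]
  rw [tsum_mul_left, tsum_geometric_of_lt_one (Real.exp_pos _).le hq, div_eq_mul_inv]

/-- `e^{−a}(e^{−4a})^K = e^{−a(4K+1)}`. [cite: Yoshida1992HermitianForms, §5 pp. 301–302 ((5.15)/(5.16) and "the sums converge rapidly")] -/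
theorem exp_geom_pow_eq (a : ℝ) (K : ℕ) :
    Real.exp (-a) * Real.exp (-(4 * a)) ^ K = Real.exp (-(a * (4 * K + 1))) := by
  rw [← Real.exp_nat_mul, ← Real.exp_add]; congr 1; ring

/-- **Tail of the diagonal exponential sum**: for `K ≥ 1`,
`|archExpSumDiag a n − Σ_{k<K} diagTerm| ≤ e^{−a(4K+1)}/(1 − e^{−4a})`. [cite: Yoshida1992HermitianForms, §5 pp. 301–302 ((5.15)/(5.16) and "the sums converge rapidly")] -/
theorem abs_archExpSumDiag_sub_sum_le (ha : 0 < a) (n : ℤ) {K : ℕ} (hK : 1 ≤ K) :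
    |archExpSumDiag a n - ∑ k ∈ Finset.range K, diagTerm a n k|
      ≤ Real.exp (-(a * (4 * K + 1))) / (1 - Real.exp (-(4 * a))) := by
  have hs := summable_diagTerm ha n
  rw [archExpSumDiag_eq_tsum, ← hs.sum_add_tsum_nat_add K, add_sub_cancel_left, ← exp_geom_pow_eq,
    ← tsum_exp_geom_shift ha K]
  have hs' : Summable fun k ↦ Real.exp (-a) * Real.exp (-(4 * a)) ^ (k + K) :=
    (summable_exp_geom ha).comp_injective (add_left_injective K)
  have hsK := hs.comp_injective (add_left_injective K)
  have h1 : |∑' k, diagTerm a n (k + K)| ≤ ∑' k, |diagTerm a n (k + K)| := by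
    have := norm_tsum_le_tsum_norm hsK.norm
    simpa only [Real.norm_eq_abs, Function.comp] using this
  refine h1.trans ?_
  refine Summable.tsum_le_tsum (fun k ↦ ?_) hsK.abs hs'
  exact abs_diagTerm_le_of_one_le a n (by omega)

/-- **Tail of the off-diagonal exponential sum**: `|archExpSumSin a n − Σ_{k<K} sinTerm| ≤ e^{−a(4K+1)}/(1 − e^{−4a})`.
[cite: Yoshida1992HermitianForms, §5 pp. 301–302 ((5.15)/(5.16) and "the sums converge rapidly")] -/
theorem abs_archExpSumSin_sub_sum_le (ha : 0 < a) (n : ℤ) (K : ℕ) :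
    |archExpSumSin a n - ∑ k ∈ Finset.range K, sinTerm a n k|
      ≤ Real.exp (-(a * (4 * K + 1))) / (1 - Real.exp (-(4 * a))) := by
  have hs := summable_sinTerm ha n
  rw [archExpSumSin_eq_tsum, ← hs.sum_add_tsum_nat_add K, add_sub_cancel_left, ← exp_geom_pow_eq,
    ← tsum_exp_geom_shift ha K]
  have hs' : Summable fun k ↦ Real.exp (-a) * Real.exp (-(4 * a)) ^ (k + K) :=
    (summable_exp_geom ha).comp_injective (add_left_injective K)
  have hsK := hs.comp_injective (add_left_injective K)
  have h1 : |∑' k, sinTerm a n (k + K)| ≤ ∑' k, |sinTerm a n (k + K)| := by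
    have := norm_tsum_le_tsum_norm hsK.norm
    simpa only [Real.norm_eq_abs, Function.comp] using this
  refine h1.trans ?_
  exact Summable.tsum_le_tsum (fun k ↦ abs_sinTerm_le a n _) hsK.abs hs'

/-! ## 3. The prime powers of the window as list data -/

/-- A prime power `k = p^e` of the window (`e log p < 2a`), as data. [cite: Yoshida1992HermitianForms, §5 (5.15) p. 301] -/
structure PrimeLen where
  /-- the prime -/
  p : ℕ
  /-- the exponent (`≥ 1`) -/
  e : ℕ
  deriving DecidableEq, Repr, Inhabited

namespace PrimeLen

/-- `k = p^e`. [folklore] -/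
def val (q : PrimeLen) : ℕ := q.p ^ q.e

/-- The length `ℓ = log k = e log p`. [folklore] -/
noncomputable def len (q : PrimeLen) : ℝ := q.e * Real.log q.p

/-- The weight `Λ(k) k^{−1/2} = log p · e^{−ℓ/2}`. [folklore] -/
noncomputable def wt (q : PrimeLen) : ℝ := Real.log q.p * Real.exp (-(q.len / 2))

/-- `log k = ℓ`. [cite: Yoshida1992HermitianForms, §5 pp. 301–302 ((5.15)/(5.16) and "the sums converge rapidly")] -/
theorem log_val (q : PrimeLen) : Real.log (q.val : ℝ) = q.len := by
  unfold val len; push_cast; rw [Real.log_pow]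

/-- `Λ(k)/√k = log p · e^{−ℓ/2}` for `k = p^e`, `p` prime, `e ≥ 1`. [cite: Yoshida1992HermitianForms, §5 pp. 301–302 ((5.15)/(5.16) and "the sums converge rapidly")] -/
theorem vonMangoldt_div_sqrt_val {q : PrimeLen} (hq : q.p.Prime ∧ 0 < q.e) :
    (Λ q.val : ℝ) / Real.sqrt q.val = q.wt := by
  have hk0 : (0 : ℝ) < q.val := by
    unfold val; exact_mod_cast pow_pos hq.1.pos _
  have hΛ : (Λ q.val : ℝ) = Real.log q.p := by
    unfold val
    rw [ArithmeticFunction.vonMangoldt_apply_pow (Nat.pos_iff_ne_zero.mp hq.2),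
      ArithmeticFunction.vonMangoldt_apply_prime hq.1]
  have hsqrt : Real.sqrt q.val = Real.exp (q.len / 2) := by
    have hsq : Real.exp (q.len / 2) ^ 2 = (q.val : ℝ) := by
      rw [← Real.exp_nat_mul]; push_cast
      rw [show (2 : ℝ) * (q.len / 2) = q.len by ring, ← q.log_val, Real.exp_log hk0]
    conv_lhs => rw [← hsq]
    exact Real.sqrt_sq (Real.exp_pos _).le
  rw [hΛ, hsqrt, wt, Real.exp_neg, div_eq_mul_inv]

/-- `k = p^e` is a prime power. [cite: Yoshida1992HermitianForms, §5 pp. 301–302 ((5.15)/(5.16) and "the sums converge rapidly")] -/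
theorem isPrimePow_val {q : PrimeLen} (hq : q.p.Prime ∧ 0 < q.e) : IsPrimePow q.val :=
  (hq.1.isPrimePow).pow (Nat.pos_iff_ne_zero.mp hq.2)

end PrimeLen

/-- **Prime data of the window `[−a, a]`**: the list `ks` consists of genuine prime powers, without repetition,
and a prime power lies in `weilPrimeIndex a` (`log k < 2a`) iff it is listed. [cite: Yoshida1992HermitianForms, §5 pp. 301–302 ((5.15)/(5.16) and "the sums converge rapidly")] -/
structure PrimeData (a : ℝ) (ks : List PrimeLen) : Prop where
  /-- every entry is `p^e` with `p` prime and `e ≥ 1` -/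
  prime : ∀ q ∈ ks, q.p.Prime ∧ 0 < q.e
  /-- no prime power is listed twice -/
  nodup : (ks.map PrimeLen.val).Nodup
  /-- the list is exactly the set of prime powers of the window -/
  mem_iff : ∀ k, IsPrimePow k → (k ∈ weilPrimeIndex a ↔ k ∈ ks.map PrimeLen.val)

/-- **The prime coefficient as a list sum** over the prime data:
`primeCoeff a n m = Σ_{q ∈ ks} Λ(q)q^{−1/2}·(K_{ℓ_q}(n,m) − 2δ_{nm})`. [cite: Yoshida1992HermitianForms, §5 (5.15)-(5.16) p. 301] -/
theorem primeCoeff_eq_listSum {ks : List PrimeLen} (h : PrimeData a ks) (n m : ℤ) :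
    primeCoeff a n m = (ks.map fun q ↦ q.wt * (incrCoeff a q.len n m - if n = m then 2 else 0)).sum := by
  unfold primeCoeff
  have step1 : ∑ k ∈ weilPrimeIndex a, (Λ k : ℝ) / Real.sqrt k * (incrCoeff a (Real.log k) n m - if n = m then 2 else 0)
      = ∑ k ∈ (weilPrimeIndex a).filter IsPrimePow,
          (Λ k : ℝ) / Real.sqrt k * (incrCoeff a (Real.log k) n m - if n = m then 2 else 0) := by
    refine (Finset.sum_filter_of_ne fun k _ hne ↦ ?_).symm
    by_contra hk
    rw [ArithmeticFunction.vonMangoldt_eq_zero_iff.mpr hk] at hne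
    simp at hne
  have step2 : (weilPrimeIndex a).filter IsPrimePow = (ks.map PrimeLen.val).toFinset := by
    ext k
    simp only [Finset.mem_filter, List.mem_toFinset]
    constructor
    · rintro ⟨hk, hpp⟩; exact (h.mem_iff k hpp).1 hk
    · intro hk
      have hpp : IsPrimePow k := by
        obtain ⟨q, hq, rfl⟩ := List.mem_map.1 hk
        exact PrimeLen.isPrimePow_val (h.prime q hq)
      exact ⟨(h.mem_iff k hpp).2 hk, hpp⟩
  rw [step1, step2, List.sum_toFinset _ h.nodup, List.map_map]
  congr 1
  refine List.map_congr_left fun q hq ↦ ?_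
  simp only [Function.comp_apply]
  rw [PrimeLen.vonMangoldt_div_sqrt_val (h.prime q hq), PrimeLen.log_val]

end Literature.NumberTheory.LFunctions.Yoshida1992
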